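import Summits.NavierStokesRegularity.NavierStokesRegularity.Theorems.SoloSalvageShahmurov2026b
import Literature.Analysis.FluidPDE.KNSSSwirlFromVorticity
import Literature.Analysis.FluidPDE.KNSSSwirlSupNonpos
import Literature.Analysis.FluidPDE.LeiZhang2011RegularityLerayHopf
import Literature.Analysis.FluidPDE.ChenHouMeridianSystem
import HarnessLib

/-!
# C12 `Shahmurov2026b` — salvage, part 3: Step 4 (Theorem 12.1) is true as typed

Cell `ns-claims` (D-0090 NS-CLAIMS SWEEP), salvage seat `ns-claims-salvage-p5`; continuation of
`Theorems/SoloSalvageShahmurov2026b.lean` (part 1: `step_3_holds`, `step_4_core`, …) and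
`Theorems/SoloSalvageShahmurov2026bClayDelta.lean` (part 2: the Clay delta). Part 1 proved Step 4 of
the skeleton `Literature/Claims/NS/Shahmurov2026b.lean` (typist-8, p464917) — the vorticity scaling
(12.3)–(12.4) of the self-similar field and the divergence `∫₀^{T*}‖ω‖_∞ = ∞` — for every profile
field whose vorticity is not identically zero (`step_4_core`). This file removes that proviso for the
EXACT PROFILES of the paper:

* `isAxisymmetric_reconstruct` — the reconstruction `ū = ū^ρ e_ρ + ρΩ̄ e_θ + ū^ζ e_z` (Def 3.1 /
  (12.2)) is axisymmetric;
* `swirl_reconstruct_meridianPoint` — its swirl is `Γ = ρ²Ω̄`;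
* `iSup_enorm_curl_ne_zero` — an exact profile (`IsExactProfile`: smooth field agreeing with the
  reconstruction off the axis, `Ω̄ ≢ 0`) has `curl ū ≢ 0`: a smooth curl-free axisymmetric field has
  no swirl (tree `swirl_eq_zero_of_curl_eq_zero_of_isAxisymmetric`, KNSS 2009 §5), so `ρ²Ω̄ ≡ 0`;
* `step_4_holds : Step_4` — **Step 4 (Thm 12.1 (12.1)–(12.4) + BKM divergence) kernel-discharged.**

WHAT THIS IS NOT: not a claim about NS regularity or blow-up; not a claim about any author beyond
the typed locator.
-/

noncomputable section

open Set Filter MeasureTheory Function WithLp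
open scoped Topology ENNReal ContDiff

-- The mandated landing namespace repeats the summit name by design (D-0017).
set_option linter.dupNamespace false

namespace Summit.NavierStokesRegularity.NavierStokesRegularity.Theorems

namespace Shahmurov2026b

open Literature.Claims.NS.Shahmurov2026b Literature.Analysis Literature.Analysis.FluidPDE

section StepFourFull

/-- The radial frame vector is rotation-equivariant (restated privately; cf. the tree's `eR_rotZ`). [folklore] -/
private theorem eR_rotZ' (θ : ℝ) (x : EuclideanSpace ℝ (Fin 3)) : eR (rotZ θ x) = rotZ θ (eR x) := by
  rw [eR, eR, cylRadius_rotZ]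
  ext i
  fin_cases i <;> simp [rotZ] <;> ring

/-- The angular frame vector is rotation-equivariant (cf. the tree's `eTheta_rotZ`). [folklore] -/
private theorem eTheta_rotZ' (θ : ℝ) (x : EuclideanSpace ℝ (Fin 3)) :
    eTheta (rotZ θ x) = rotZ θ (eTheta x) := by
  rw [eTheta, eTheta, cylRadius_rotZ]
  ext i
  fin_cases i <;> simp [rotZ] <;> ring

/-- The axial frame vector is rotation-invariant (cf. the tree's `rotZ_eZ`). [folklore] -/
private theorem rotZ_eZ' (θ : ℝ) : rotZ θ (eZ : EuclideanSpace ℝ (Fin 3)) = eZ := by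
  ext i
  fin_cases i <;> simp [rotZ, eZ]

/-- The meridian coordinates are rotation-invariant (cf. the tree's `meridian_rotZ`). [folklore] -/
private theorem meridian_rotZ' (θ : ℝ) (x : EuclideanSpace ℝ (Fin 3)) :
    meridian (rotZ θ x) = meridian x := by
  simp [meridian, cylRadius_rotZ]

/-- Rotations about the axis are linear: `R_θ(a • v + b • w + c • e) = a • R_θ v + b • R_θ w + c • R_θ e`. [folklore] -/
private theorem rotZ_lincomb (θ a b c : ℝ) (v w e : EuclideanSpace ℝ (Fin 3)) :
    rotZ θ (a • v + b • w + c • e) = a • rotZ θ v + b • rotZ θ w + c • rotZ θ e := by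
  ext i
  fin_cases i <;> simp [rotZ] <;> ring

/-- **The reconstruction (12.2)/Def 3.1 is axisymmetric** — everywhere, junk values on the axis
included (there `e_r = e_θ = 0` and the field is vertical). [cite: Shahmurov2026b, Def 3.1 p.2] -/
theorem isAxisymmetric_reconstruct (Ω ψ : ℝ × ℝ → ℝ) : IsAxisymmetric (reconstruct Ω ψ) := by
  intro θ y
  simp only [reconstruct, meridian_rotZ', cylRadius_rotZ, eR_rotZ', eTheta_rotZ']
  rw [rotZ_lincomb, rotZ_eZ']

/-- **The swirl of the reconstructed field is `ρ²Ω̄`** at the meridian point `(ρ, 0, ζ)`, `ρ > 0`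
(Def 3.1: `Ω = u^θ/r`). [cite: Shahmurov2026b, Def 3.1 p.2] -/
theorem swirl_reconstruct_meridianPoint (Ω ψ : ℝ × ℝ → ℝ) {q : ℝ × ℝ} (hq : 0 < q.1) :
    swirl (reconstruct Ω ψ) (meridianPoint q) = q.1 ^ 2 * Ω q := by
  have hr : cylRadius (meridianPoint q) = q.1 := cylRadius_meridianPoint hq.le
  have hm : meridian (meridianPoint q) = q := meridian_meridianPoint hq.le
  have h0 : meridianPoint q 0 = q.1 := by simp [meridianPoint]
  have h1 : meridianPoint q 1 = 0 := by simp [meridianPoint]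
  have heR : eR (meridianPoint q) 1 = 0 := by simp [eR, h1]
  have heT : eTheta (meridianPoint q) 1 = 1 := by
    simp [eTheta, hr, h0, inv_mul_cancel₀ hq.ne']
  have heZ : (eZ : EuclideanSpace ℝ (Fin 3)) 1 = 0 := by simp [eZ]
  simp only [swirl, reconstruct, hr, hm, h0, h1, PiLp.add_apply, PiLp.smul_apply, smul_eq_mul, heR,
    heT, heZ]
  ring

/-- **An exact profile has non-vanishing vorticity**: if `curl ū ≡ 0` then, `ū` being smooth and
axisymmetric (it agrees with the axisymmetric reconstruction off the axis, a null set away from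
everything), its swirl `Γ = x₀ū₁ − x₁ū₀` vanishes identically (tree
`swirl_eq_zero_of_curl_eq_zero_of_isAxisymmetric`, KNSS 2009 §5), i.e. `ρ²Ω̄ ≡ 0` on the
half-plane — contradicting the non-triviality of the profile (Thm 11.1 + App. A).
[cite: Shahmurov2026b, Thm 12.1 p.9 and Thm 11.1 pp.8–9] -/
theorem iSup_enorm_curl_ne_zero {ν : ℝ} {Ω ψ : ℝ × ℝ → ℝ}
    {ubar : EuclideanSpace ℝ (Fin 3) → EuclideanSpace ℝ (Fin 3)} (hP : IsExactProfile ν Ω ψ ubar) :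
    (⨆ x : EuclideanSpace ℝ (Fin 3), ‖curl ubar x‖ₑ) ≠ 0 := by
  intro h0
  have hcurl : ∀ y, curl ubar y = 0 := fun y => by
    have h := (ENNReal.iSup_eq_zero.1 h0) y
    rwa [enorm_eq_zero] at h
  have hae : reconstruct Ω ψ =ᵐ[volume] ubar :=
    ae_cylRadius_ne_zero.mono fun y hy => (hP.field_eq y hy).symm
  have hax : IsAxisymmetric ubar :=
    (isAxisymmetric_reconstruct Ω ψ).of_ae_eq hae hP.field_smooth.continuous
  have hd : Differentiable ℝ ubar := hP.field_smooth.differentiable (by simp)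
  obtain ⟨q, hq, hΩ⟩ := hP.nontrivial
  have hsw := swirl_eq_zero_of_curl_eq_zero_of_isAxisymmetric hd hcurl hax (meridianPoint q)
  have hy : cylRadius (meridianPoint q) ≠ 0 := by
    rw [cylRadius_meridianPoint hq.le]; exact hq.ne'
  have hsw' : swirl (reconstruct Ω ψ) (meridianPoint q) = 0 := by
    have : swirl ubar (meridianPoint q) = swirl (reconstruct Ω ψ) (meridianPoint q) := by
      simp only [swirl, hP.field_eq _ hy]
    rw [← this]; exact hsw
  rw [swirl_reconstruct_meridianPoint Ω ψ hq] at hsw'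
  exact hΩ ((mul_eq_zero.1 hsw').resolve_left (pow_ne_zero 2 hq.ne'))

/-- **Step 4 of the skeleton (Theorem 12.1, (12.1)–(12.4) p. 9 + the BKM divergence) is TRUE as typed —
kernel-discharged**: `step_4_core` (part 1) for every profile field with `ω̄ ≢ 0`, and
`iSup_enorm_curl_ne_zero` (exact profiles have `ω̄ ≢ 0`). [cite: Shahmurov2026b, Thm 12.1 eqs. (12.1)–(12.4) p.9] -/
theorem step_4_holds : Literature.Claims.NS.Shahmurov2026b.Step_4 := by
  intro ν hν T hT Ω ψ ubar hP
  exact step_4_core hT ubar (iSup_enorm_curl_ne_zero hP)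

end StepFourFull

end Shahmurov2026b

end Summit.NavierStokesRegularity.NavierStokesRegularity.Theorems

end
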